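import Summits.FinalStateConjecture.FinalStateConjecture.Theorems.PhotonSphereChannelsTameHullDefs

/-!
# `ChannelsResolveTameDevelopments` (stmt-FinalStateConjecture-10046, route PhotonSphereChannels) —
# negative-side lemmas III: tame ends with EMPTY future event horizon (line `tame-hull-exact-rigidity-only`, stub C)

Over the landed vocabulary of the line (`Theorems/PhotonSphereChannelsTameHullDefs.lean`, namespace
`…Theorems.TameHull`): the FUTURE-horizon hypotheses of the registered stub
`stub_eternalDoublySilentRigidity` (C) — `EndDatum.IsSilentHorizon`, `EndDatum.IsRedShifted κ₀` — hold
VACUOUSLY on an end whose future event horizon `E.horizon = ∂I⁻(far) ∩ I⁺(far)` is empty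
(`isSilentHorizon_of_horizon_eq_empty`, `isRedShifted_of_horizon_eq_empty`; the cold branch of stub D is
excluded there, `not_isColdHorizon_of_horizon_eq_empty`), so C reduces on such ends to "tame + two-sided
non-radiating ⇒ SUB-extremal Kerr d.o.c. or Minkowski", and any tame non-radiating end with empty future
horizon which is neither is a counterexample (`not_eternalDoublySilentRigidity_of_emptyHorizonEnd`, the
statement of C inlined verbatim). The paper witness is the OUTGOING (white-hole) Kerr–Schild patch of
EXTREMAL Kerr, `|a| = M > 0` (`Kerr.spacetime M M (17M/20)` with reversed time orientation; tame via the
stationary clock `v − ∫p dr`, `p ∈ (5/12, 3/4)` at `r = M`): its d.o.c. is the extremal exterior, so the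
strict `|a| < M` of C fails while the repaired conclusion `|a| ≤ M` (all the line's composition uses) holds —
evidence file `DrefuteG2-stub_eternalDoublySilentRigidity.md` of the crux directory.

Refuter seat `refuter-drefute-stmt-FinalStateConjecture-10046-g2-0`, 2026-08-16. No new definitions.

## References

* M. Dafermos, I. Rodnianski, *Lectures on black holes and linear waves*, arXiv:0811.0354, §7.1
  (surface gravity hypothesis; key `DafermosRodnianski2008`).
* R. M. Wald, *General Relativity* (1984), §12.1 (event horizon of an end; key `Wald1984`).
-/

noncomputable section

set_option maxSynthPendingDepth 3
set_option linter.dupNamespace false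

open Set Filter Function TopologicalSpace Manifold Bundle
open scoped Topology Manifold ContDiff ENNReal NNReal

namespace Summit.FinalStateConjecture.FinalStateConjecture.Theorems.ChannelsResolveTameDevelopments.Negative

open Literature.Geometry.Lorentzian
open Summit.FinalStateConjecture.FinalStateConjecture.Theorems.TameHull

variable {𝓢 : Spacetime.{0} 4}

/-- An end datum whose future event horizon is empty is (vacuously) horizon-silent: take `L = 0` on
the empty neighbourhood. Documented vacuity of `EndDatum.IsSilentHorizon` (Wald 1984, §12.1: no black
hole, nothing to be silent). [folklore] -/
theorem isSilentHorizon_of_horizon_eq_empty (E : EndDatum 𝓢) (h : E.horizon = ∅) :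
    E.IsSilentHorizon := by
  intro _inst
  refine ⟨fun _ ↦ 0, ⟨∅, isOpen_empty, by simp [h], fun x hx ↦ hx.elim⟩, ?_, ?_⟩
  · intro p hp; simp [h] at hp
  · intro γ a b _ _ ha; simp [h] at ha

/-- An end datum whose future event horizon is empty is (vacuously) uniformly red-shifted for every
`κ₀` (`LorentzianMetric.hasSurfaceGravityGe_empty`; Dafermos–Rodnianski arXiv:0811.0354, §7.1). [folklore] -/
theorem isRedShifted_of_horizon_eq_empty (E : EndDatum 𝓢) (h : E.horizon = ∅) (κ₀ : ℝ) :
    E.IsRedShifted κ₀ := by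
  intro _inst
  show 𝓢.metric.HasSurfaceGravityGe 𝓢.timeOrientation E.horizon E.clock κ₀
  rw [h]
  exact LorentzianMetric.hasSurfaceGravityGe_empty _ _

/-- An end datum whose future event horizon is empty is never cold (`EndDatum.IsColdHorizon` demands a
nonempty horizon): on such ends only the red-shifted branch of stub B's dichotomy — i.e. stub C — applies. [folklore] -/
theorem not_isColdHorizon_of_horizon_eq_empty (E : EndDatum 𝓢) (h : E.horizon = ∅) :
    ¬ E.IsColdHorizon := fun hc ↦ by simpa [h] using hc.1

/-- **Reduction of stub C to its empty-horizon case (negative form).** The statement of the registered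
stub `stub_eternalDoublySilentRigidity` of line `tame-hull-exact-rigidity-only` (inlined verbatim) is
refuted by ANY `(Λ, r₀)`-tame, two-sided non-radiating end with EMPTY future event horizon whose
spacetime is not Minkowski and whose domain of outer communications is not a SUB-extremal Kerr
exterior: the horizon hypotheses are vacuous there. Paper witness (crux file
`DrefuteG2-stub_eternalDoublySilentRigidity.md`): the outgoing Kerr–Schild patch of extremal Kerr. [folklore] -/
theorem not_eternalDoublySilentRigidity_of_emptyHorizonEnd
    (hW : ∃ (𝓢 : Spacetime.{0} 4) (E : EndDatum 𝓢) (Λ : ℝ≥0) (r₀ : ℝ), E.IsTameEnd Λ r₀ ∧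
      E.IsNonRadiating ∧ E.horizon = ∅ ∧ ¬ IsMinkowski 𝓢 ∧
        ∀ M a : ℝ, 0 < M → |a| < M → ¬ IsKerrDoc 𝓢 E.doc M a) :
    ¬ ∀ (𝓢 : Spacetime.{0} 4) (E : EndDatum 𝓢) (Λ : ℝ≥0) (r₀ : ℝ), E.IsTameEnd Λ r₀ →
      E.IsNonRadiating → E.IsSilentHorizon → (∃ κ₀ : ℝ, 0 < κ₀ ∧ E.IsRedShifted κ₀) →
        (∃ M a : ℝ, 0 < M ∧ |a| < M ∧ IsKerrDoc 𝓢 E.doc M a) ∨ IsMinkowski 𝓢 := by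
  rintro hC
  obtain ⟨𝓢, E, Λ, r₀, htame, hnr, hhor, hMink, hKerr⟩ := hW
  rcases hC 𝓢 E Λ r₀ htame hnr (isSilentHorizon_of_horizon_eq_empty E hhor)
      ⟨1, one_pos, isRedShifted_of_horizon_eq_empty E hhor 1⟩ with ⟨M, a, hM, ha, hK⟩ | h
  · exact hKerr M a hM ha hK
  · exact hMink h

/-- **The repair is a weakening.** Stub C with conclusion `|a| < M` implies the repaired statement C′
with `|a| ≤ M` — the only form the line's composition `channelsResolveTameDevelopments_of_stubs` consumes
(`ha.le`); the extremal white-hole witness satisfies C′. [folklore] -/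
theorem eternalDoublySilentRigidity_repaired_of
    (hC : ∀ (𝓢 : Spacetime.{0} 4) (E : EndDatum 𝓢) (Λ : ℝ≥0) (r₀ : ℝ), E.IsTameEnd Λ r₀ →
      E.IsNonRadiating → E.IsSilentHorizon → (∃ κ₀ : ℝ, 0 < κ₀ ∧ E.IsRedShifted κ₀) →
        (∃ M a : ℝ, 0 < M ∧ |a| < M ∧ IsKerrDoc 𝓢 E.doc M a) ∨ IsMinkowski 𝓢) :
    ∀ (𝓢 : Spacetime.{0} 4) (E : EndDatum 𝓢) (Λ : ℝ≥0) (r₀ : ℝ), E.IsTameEnd Λ r₀ →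
      E.IsNonRadiating → E.IsSilentHorizon → (∃ κ₀ : ℝ, 0 < κ₀ ∧ E.IsRedShifted κ₀) →
        (∃ M a : ℝ, 0 < M ∧ |a| ≤ M ∧ IsKerrDoc 𝓢 E.doc M a) ∨ IsMinkowski 𝓢 := by
  intro 𝓢 E Λ r₀ h1 h2 h3 h4
  rcases hC 𝓢 E Λ r₀ h1 h2 h3 h4 with ⟨M, a, hM, ha, hK⟩ | hm
  · exact Or.inl ⟨M, a, hM, ha.le, hK⟩
  · exact Or.inr hm

end Summit.FinalStateConjecture.FinalStateConjecture.Theorems.ChannelsResolveTameDevelopments.Negative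

end
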